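import Summits.NavierStokesRegularity.NavierStokesRegularity.Theorems.StrainDoorsTypeITangentHessian
import Summits.NavierStokesRegularity.NavierStokesRegularity.Theorems.StrainDoorsPeakDoors
import HarnessLib

/-!
# StrainDoorsNearRecordGradientRate — PART M §M7: THE NEAR-RECORD GRADIENT LAW WITH A RATE

(Tree file 1 of 2 of PART M (§M6a/§M7/§M10, ROUND 63 text A); text of nsreg-p1 r63/StrainDoorsNearRecordGradientRate.lean sha256 da07e244be2a3583, split at the 400-line cap at § boundaries,
bodies verbatim.)

nsreg-p1 g36, ROUND-63 (helper lane of `stmt-NavierStokesRegularity-0056`, rung N0; 0 ledger writes by the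
planner — text for the S-lane to land `--supports stmt-NavierStokesRegularity-0056 --as helper`; tree file 1 of 5
of ROUND-63; bodies farm-certified inside `r63/StrainDoorsR63All.lean`, rc 0 · 0 warn · 0 sorry, std axioms).

ROUNDS 60–62 produced NECESSARY LAWS at near-record points of classical Type-I ancient solutions by compactness
(extraction of a Type-I tangent peak + transfer): a `δ(C₀,w₀,ε) > 0` EXISTS.  This file shows that the FIRST-ORDER
law is QUANTITATIVE and needs no blow-up sequence at all: rescale the near-record point to time `−1`; the function
`f = |ω'(−1,·)|²` is bounded by `W²`, is within `2Wδ` of `W²` at the point, and has an `L(C₀)`-Lipschitz gradient by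
the uniform `C^{2,1}` bounds of the Type-I class (PART H, PART M §M1); the one-sided Taylor estimate
`f(z + h) ≥ f(z) + ∇f(z)·h − L|h|²` at a near-maximum then forces `|∇f(z)| ≤ 2√((W² − f(z)) L)` (Fermat with a rate).

* `fderiv_norm_curl_nsRescale`, `gradNormNumber_nsRescale` — the parabolic scale law of `∇|ω|`
  (`(0 − t)^{3/2}‖∇|ω|(t,x)‖` is scale-invariant);
* `linear_le_two_sqrt_of_forall_quadratic`, `norm_fderiv_le_two_sqrt_of_le` — Fermat at a near-maximum WITH A
  RATE for a function with Lipschitz gradient;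
* ★★★ `typeI_vorticityModulus_gradient_deficit` — THE DEFICIT LAW: there is `A = A(C₀)` with
  `((0 − t)|ω(t,x)|)·((0 − t)^{3/2}‖∇|ω|(t,x)‖) ≤ √(A·W·δ)` whenever `(0 − t)|ω(t,·)| ≤ W` AT THAT INSTANT and
  `(0 − t)|ω(t,x)| ≥ W − δ` — compactness-free, uniform in the class, with the explicit rate `√δ`;
* ★★ `typeI_nearRecord_gradient_rate` — `(0 − t)^{3/2}‖∇|ω|(t,x)‖ ≤ A(C₀,w₀)·√δ` for `W ≥ w₀`, `δ ≤ w₀/2`;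
* `typeI_nearRecord_gradient_pinch` — the qualitative `ε`–`δ` pinch with the explicit `δ = min(w₀/2, (ε/(A+1))²)`;
* §M10 THE SET STRUCTURE OF NEAR-RECORDS (answers ref3 R62-R1: a SET statement with an explicit class constant,
  separate from the pointwise laws): ★ `typeI_vorticityNumber_spatial_transfer` — `(0 − t)|ω(t,x)| ≤
  (0 − t)|ω(t,y)| + K(C₀)·|y − x|/√(0 − t)` (the vorticity number is `K`-Lipschitz in the parabolic variable);
  ★ `typeI_vorticityNumber_temporal_transfer` — `(0 − t)|ω(t,x)| ≤ (0 − s)|ω(s,x)| + K(C₀)·(t − s)/(0 − t)` for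
  `2t ≤ s ≤ t`; hence a `δ`-near-record at `(t,x)` makes the whole parabolic cylinder of radius `r√(0 − t)` a set of
  `(δ + Kr)`-near-records, and ★★ `typeI_nearRecord_gradient_rate_ball` — the gradient law holds ON THE BALL:
  `(0 − t)^{3/2}‖∇|ω|(t,y)‖ ≤ A√(δ + K r)` for `|y − x| ≤ r√(0 − t)`, `δ + K r ≤ w₀/2`.

WHAT THIS IS NOT: necessary conditions at near-record points; nothing here excludes a blow-up; `0056` / `10661` /
NS regularity are NOT proved; the peak doors of PART K stay OPEN.  No new definitions; no sorry.
[cite: KochNadirashviliSereginSverak2009, §2 p. 5, (4.11); ChaeWolf2017RemovingDSS, §3 Step 2;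
ConstantinFefferman1993, §1]
-/

noncomputable section

open MeasureTheory Set Function Filter Metric Real InnerProductSpace
open _root_.Topology
open scoped ENNReal NNReal RealInnerProductSpace ContDiff Laplacian
open Literature.Analysis Literature.Analysis.FluidPDE
open Literature.Analysis.FluidPDE.VorticityDirectionDynamics

set_option linter.dupNamespace false
set_option maxSynthPendingDepth 3

namespace Summit.NavierStokesRegularity.NavierStokesRegularity.Theorems.StrainDoors

open Summit.NavierStokesRegularity.NavierStokesRegularity.Theorems.ArgmaxDoors

/-! ## §M6a Scale laws of the vorticity-modulus gradient -/

/-- **Scale law of the vorticity-modulus gradient**: `D|ω_λ(s,·)|(y) = λ³ • (D|ω(λ²s,·)|)(λy)`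
(`fderiv_nsRescale`, `curl = curlCLM ∘ ∇` and the dilation rule `D(k·U(c·)) = (kc)·DU(c·)`; no differentiability needed). [folklore] -/
theorem fderiv_norm_curl_nsRescale (c : ℝ) (u : ℝ → (EuclideanSpace ℝ (Fin 3)) → (EuclideanSpace ℝ (Fin 3)))
    (s : ℝ) (y : EuclideanSpace ℝ (Fin 3)) :
    fderiv ℝ (fun y => ‖curl (nsRescale c u s) y‖) y =
      (c ^ 2 * c) • fderiv ℝ (fun y => ‖curl (u (c ^ 2 * s)) y‖) (c • y) := by
  have h2 := fderiv_const_smul_comp_smul' (fun y' => ‖curl (u (c ^ 2 * s)) y'‖) (c ^ 2) c y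
  have h1 : (fun y => ‖curl (nsRescale c u s) y‖) = fun y => c ^ 2 * ‖curl (u (c ^ 2 * s)) (c • y)‖ := by
    funext y
    rw [curl_eq_curlCLM, curl_eq_curlCLM, fderiv_nsRescale, map_smul, norm_smul,
      Real.norm_of_nonneg (sq_nonneg c)]
  rw [h1]
  exact h2

/-- **The gradient number of `|ω|` is scale invariant**:
`(0 − s)·√(0 − s)·‖D|ω_λ(s,·)|(y)‖ = (0 − λ²s)·√(0 − λ²s)·‖D|ω(λ²s,·)|(λy)‖` for `λ > 0`. [folklore] -/
theorem gradNormNumber_nsRescale {c : ℝ} (hc : 0 < c)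
    (u : ℝ → (EuclideanSpace ℝ (Fin 3)) → (EuclideanSpace ℝ (Fin 3))) (s : ℝ) (y : EuclideanSpace ℝ (Fin 3)) :
    (0 - s) * √(0 - s) * ‖fderiv ℝ (fun y => ‖curl (nsRescale c u s) y‖) y‖ =
      (0 - c ^ 2 * s) * √(0 - c ^ 2 * s) * ‖fderiv ℝ (fun y => ‖curl (u (c ^ 2 * s)) y‖) (c • y)‖ := by
  rw [fderiv_norm_curl_nsRescale, norm_smul, Real.norm_of_nonneg (by positivity : (0:ℝ) ≤ c ^ 2 * c),
    show 0 - c ^ 2 * s = c ^ 2 * (0 - s) by ring, Real.sqrt_mul (sq_nonneg c), Real.sqrt_sq hc.le]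
  ring

/-! ## §M7 The near-record gradient law WITH A RATE (ROUND 63): one-sided Taylor at a near-maximum

First-order near-record laws are QUANTITATIVE and compactness-free: a near-maximum of a function with
Lipschitz gradient is a near-critical point, with rate `√δ`.  Applied to `|ω'|²` for the rescaled solution at
time `−1` (uniform `C^{2,1}` bounds of the Type-I class, PART H / §M1) this gives the near-record gradient law
with the explicit rate `δ ↦ 2√(A₀δ/w₀)`, assuming domination by `W` only at the instant `t`. -/

/-- Real-variable lemma: if `a·s ≤ b + c·s²` for every `s > 0` (`b, c ≥ 0`) then `a ≤ 2√(bc)`. [folklore] -/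
theorem linear_le_two_sqrt_of_forall_quadratic {a b c : ℝ} (hb : 0 ≤ b) (hc : 0 ≤ c)
    (h : ∀ s : ℝ, 0 < s → a * s ≤ b + c * s ^ 2) : a ≤ 2 * √(b * c) := by
  by_contra H
  push Not at H
  have ha : 0 < a := lt_of_le_of_lt (by positivity) H
  rcases hc.eq_or_lt with hc0 | hc0
  · -- `c = 0`: `a·s ≤ b` for all `s`, absurd at `s = b/a + 1`
    have h1 := h (b / a + 1) (by positivity)
    rw [← hc0, zero_mul, add_zero] at h1
    have e : a * (b / a + 1) = b + a := by field_simp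
    linarith
  rcases hb.eq_or_lt with hb0 | hb0
  · -- `b = 0`: `a·s ≤ c·s²` for all `s`, absurd at `s = a/(2c)`
    have h1 := h (a / (2 * c)) (by positivity)
    rw [← hb0, zero_add] at h1
    have e1 : a * (a / (2 * c)) = 2 * (a ^ 2 / (4 * c)) := by field_simp; ring
    have e2 : c * (a / (2 * c)) ^ 2 = a ^ 2 / (4 * c) := by field_simp; ring
    have hq : 0 < a ^ 2 / (4 * c) := by positivity
    linarith
  · -- `b, c > 0`: `s = √b/√c`
    have hsb : 0 < √b := Real.sqrt_pos.mpr hb0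
    have hsc : 0 < √c := Real.sqrt_pos.mpr hc0
    have hs : 0 < √b / √c := div_pos hsb hsc
    have h1 := h (√b / √c) hs
    have e1 : c * (√b / √c) ^ 2 = b := by
      rw [div_pow, Real.sq_sqrt hb, Real.sq_sqrt hc]; field_simp
    have e2 : 2 * √(b * c) * (√b / √c) = 2 * b := by
      rw [Real.sqrt_mul hb]
      calc 2 * (√b * √c) * (√b / √c) = 2 * (√b * √b) * (√c / √c) := by ring
        _ = 2 * b := by rw [Real.mul_self_sqrt hb, div_self hsc.ne', mul_one]
    have h2 : a * (√b / √c) ≤ 2 * √(b * c) * (√b / √c) := by rw [e2]; linarith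
    exact absurd (le_of_mul_le_mul_right h2 hs) (not_le.mpr H)

/-- **Fermat with a rate (one-sided Taylor at a near-maximum).**  If `f : ℝ³ → ℝ` is differentiable with
`K`-Lipschitz gradient and `f ≤ M` everywhere, then `‖∇f(x)‖ ≤ 2√((M − f x)·K)` at EVERY point `x`: where `f`
is within `δ` of an upper bound it is `2√(Kδ)`-critical. [folklore] -/
theorem norm_fderiv_le_two_sqrt_of_le {f : EuclideanSpace ℝ (Fin 3) → ℝ} (hd : Differentiable ℝ f)
    {K M : ℝ} (hK : 0 ≤ K) (hL : ∀ x y, ‖fderiv ℝ f x - fderiv ℝ f y‖ ≤ K * ‖x - y‖) (hM : ∀ y, f y ≤ M)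
    (x : EuclideanSpace ℝ (Fin 3)) : ‖fderiv ℝ f x‖ ≤ 2 * √((M - f x) * K) := by
  have hMf : 0 ≤ M - f x := by linarith [hM x]
  have key : ∀ v : EuclideanSpace ℝ (Fin 3), ‖v‖ = 1 → fderiv ℝ f x v ≤ 2 * √((M - f x) * K) := by
    intro v hv
    refine linear_le_two_sqrt_of_forall_quadratic hMf hK fun s hs => ?_
    have h1 := taylor_quadratic_of_fderiv_lipschitz hd hK hL x (s • v)
    rw [norm_smul, hv, mul_one, Real.norm_of_nonneg hs.le, Real.norm_eq_abs] at h1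
    have h2 := (abs_le.mp h1).1
    rw [map_smul, smul_eq_mul] at h2
    have h3 := hM (x + s • v)
    nlinarith
  refine ContinuousLinearMap.opNorm_le_of_unit_norm (by positivity) fun v hv => ?_
  rw [Real.norm_eq_abs, abs_le]
  refine ⟨?_, key v hv⟩
  have h := key (-v) (by rw [norm_neg, hv])
  rw [map_neg] at h
  linarith

/-- ★★★ **THE NEAR-RECORD GRADIENT LAW WITH A RATE (vorticity-modulus deficit law).**  There is
`A = A(C₀) ≥ 0` such that for every classical Type-I solution (constant `C₀`) on `t < 0`, every time `t < 0`,
every `W` dominating the scale-invariant vorticity AT THAT INSTANT (`(0 − t)|ω(t,·)| ≤ W`), every `δ ≥ 0` and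
every point `x` with `(0 − t)|ω(t,x)| ≥ W − δ`:
`((0 − t)|ω(t,x)|) · ((0 − t)^{3/2}‖∇|ω|(t,x)‖) ≤ √(A·W·δ)`.
No compactness, no floor `w₀`, no domination at other times: rescale to `t = −1`, apply Fermat-with-a-rate
to `f = |ω'|²` (`f ≤ W²`, `W² − f(z) ≤ 2Wδ`, `∇f` is `A/2`-Lipschitz by the uniform `C^{2,1}` bounds of the
class) and use `‖∇f(z)‖ = 2|ω'(z)|·‖∇|ω'|(z)‖`. [new-as-typed] -/
theorem typeI_vorticityModulus_gradient_deficit {C₀ : ℝ} (hC₀ : 0 ≤ C₀) :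
    ∃ A : ℝ, 0 ≤ A ∧
      ∀ (u : ℝ → (EuclideanSpace ℝ (Fin 3)) → (EuclideanSpace ℝ (Fin 3))) (p : ℝ → (EuclideanSpace ℝ (Fin 3)) → ℝ)
        (W t δ : ℝ) (x : EuclideanSpace ℝ (Fin 3)),
        IsClassicalNSSolutionOn (Iio 0) 1 0 u p → HasTypeIDecay C₀ u → t < 0 →
        (∀ y, (0 - t) * ‖curl (u t) y‖ ≤ W) → 0 ≤ δ → W - δ ≤ (0 - t) * ‖curl (u t) x‖ →
        ((0 - t) * ‖curl (u t) x‖) * ((0 - t) * √(0 - t) * ‖fderiv ℝ (fun y => ‖curl (u t) y‖) x‖) ≤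
          √(A * W * δ) := by
  obtain ⟨B, hB, hBb⟩ := typeI_vorticityNumber_bound hC₀
  obtain ⟨K₂, L₁, hK₂, hL₁, hG⟩ := exists_uniform_gradLipschitz hC₀
  obtain ⟨K₂', K₃', hK₂', hK₃', hH⟩ := exists_uniform_hessLipschitz hC₀
  obtain ⟨c, hc⟩ : ∃ c : ℝ, c = ‖(curlCLM : ((EuclideanSpace ℝ (Fin 3)) →L[ℝ] (EuclideanSpace ℝ (Fin 3))) →L[ℝ]
      (EuclideanSpace ℝ (Fin 3)))‖ := ⟨_, rfl⟩
  have hc0 : 0 ≤ c := by rw [hc]; exact norm_nonneg _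
  obtain ⟨L, hLdef⟩ : ∃ L : ℝ, L = 2 * ((c * K₂) * (c * K₂') + B * (c * K₃')) := ⟨_, rfl⟩
  have hL0 : 0 ≤ L := by rw [hLdef]; positivity
  refine ⟨2 * L, by positivity, fun u p W t δ x hsol hI ht hdom hδ hnear => ?_⟩
  have h14 : (-1 : ℝ) ≤ -(1 / 4 : ℝ) := by norm_num
  -- rescale to time `-1`
  obtain ⟨lam, hlam⟩ : ∃ lam : ℝ, lam = √(0 - t) := ⟨_, rfl⟩
  have hlam0 : 0 < lam := by rw [hlam]; exact Real.sqrt_pos.mpr (by linarith)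
  have hlam2 : lam ^ 2 = 0 - t := by rw [hlam]; exact Real.sq_sqrt (by linarith)
  have ht1 : lam ^ 2 * (-1) = t := by rw [hlam2]; ring
  obtain ⟨z, hz⟩ : ∃ z : EuclideanSpace ℝ (Fin 3), z = lam⁻¹ • x := ⟨_, rfl⟩
  have hxz : lam • z = x := by rw [hz]; exact smul_inv_smul₀ hlam0.ne' _
  have hcl := (typeI_class_nsRescale hlam0 hsol hI).1
  have hI' := (typeI_class_nsRescale hlam0 hsol hI).2
  -- the data at time `-1`: `w = ω'(-1,·)`, `Dw = curlCLM ∘ D²u'(-1,·)`, and their uniform bounds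
  obtain ⟨w, hw⟩ : ∃ w : (EuclideanSpace ℝ (Fin 3)) → (EuclideanSpace ℝ (Fin 3)),
      w = curl (nsRescale lam u (-1)) := ⟨_, rfl⟩
  obtain ⟨Dw, hDw⟩ : ∃ Dw : (EuclideanSpace ℝ (Fin 3)) → ((EuclideanSpace ℝ (Fin 3)) →L[ℝ]
      (EuclideanSpace ℝ (Fin 3))),
      Dw = fun y => curlCLM.comp (fderiv ℝ (fderiv ℝ (nsRescale lam u (-1))) y) := ⟨_, rfl⟩
  have hWdom : ∀ y, ‖w y‖ ≤ W := fun y => by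
    have h := hdom (lam • y)
    rw [← ht1, ← vorticityNumber_nsRescale] at h
    norm_num at h
    rw [hw]
    exact h
  have hnear' : W - δ ≤ ‖w z‖ := by
    have h := hnear
    rw [← hxz, ← ht1, ← vorticityNumber_nsRescale] at h
    norm_num at h
    rw [hw]
    linarith
  have hwB : ∀ y, ‖w y‖ ≤ B := fun y => by
    have h := hBb hcl hI' (-1) (by norm_num) y
    norm_num at h
    rw [hw]
    exact h
  have hHd : ∀ y, HasFDerivAt (fderiv ℝ (nsRescale lam u (-1)))
      (fderiv ℝ (fderiv ℝ (nsRescale lam u (-1))) y) y := fun y =>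
    ((((hcl.contDiff_velocity (show (-1 : ℝ) ∈ Iio 0 by norm_num)).fderiv_right (m := 1)
      (by norm_cast)).differentiable (by norm_cast)) y).hasFDerivAt
  have hwd : ∀ y, HasFDerivAt w (Dw y) y := fun y => by
    rw [hw, hDw]
    exact hasFDerivAt_curl_of_hasFDerivAt_fderiv (hHd y)
  have hDwB : ∀ y, ‖Dw y‖ ≤ c * K₂' := fun y => by
    rw [hDw, hc]
    exact (ContinuousLinearMap.opNorm_comp_le _ _).trans
      (mul_le_mul_of_nonneg_left ((hH hcl hI').1 (-1) h14 y) (norm_nonneg _))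
  have hDwL : ∀ a b, ‖Dw a - Dw b‖ ≤ c * K₃' * ‖a - b‖ := fun a b => by
    rw [hDw, hc]
    dsimp only
    rw [← ContinuousLinearMap.comp_sub, mul_assoc]
    exact (ContinuousLinearMap.opNorm_comp_le _ _).trans
      (mul_le_mul_of_nonneg_left ((hH hcl hI').2 (-1) h14 a b) (norm_nonneg _))
  have hwL : ∀ a b, ‖w a - w b‖ ≤ c * K₂ * ‖a - b‖ := fun a b => by
    rw [hw, hc]
    exact curl_sub_le_of_fderiv_lipschitz ((hG hcl hI').1 (-1) h14) a b
  -- `f = |w|²` and its derivative `f' y = 2 (innerSL (w y)) ∘ Dw y`, `L`-Lipschitz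
  obtain ⟨f, hf⟩ : ∃ f : (EuclideanSpace ℝ (Fin 3)) → ℝ, f = fun y => ‖w y‖ ^ 2 := ⟨_, rfl⟩
  obtain ⟨f', hf'⟩ : ∃ f' : (EuclideanSpace ℝ (Fin 3)) → ((EuclideanSpace ℝ (Fin 3)) →L[ℝ] ℝ),
      f' = fun y => (2 : ℝ) • (innerSL ℝ (w y)).comp (Dw y) := ⟨_, rfl⟩
  have hfd' : ∀ y, HasFDerivAt f (f' y) y := fun y => by
    rw [hf, hf']
    exact (hwd y).norm_sq.congr_fderiv (by simp only [two_smul])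
  have hfd : Differentiable ℝ f := fun y => (hfd' y).differentiableAt
  have hff' : ∀ y, fderiv ℝ f y = f' y := fun y => (hfd' y).fderiv
  have hfL : ∀ a b, ‖fderiv ℝ f a - fderiv ℝ f b‖ ≤ L * ‖a - b‖ := fun a b => by
    rw [hff', hff', hf']
    dsimp only
    have e : (innerSL ℝ (w a)).comp (Dw a) - (innerSL ℝ (w b)).comp (Dw b) =
        (innerSL ℝ (w a - w b)).comp (Dw a) + (innerSL ℝ (w b)).comp (Dw a - Dw b) := by
      rw [map_sub, ContinuousLinearMap.sub_comp, ContinuousLinearMap.comp_sub]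
      abel
    rw [← smul_sub, norm_smul, Real.norm_of_nonneg zero_le_two, e, hLdef]
    have h1 : ‖(innerSL ℝ (w a - w b)).comp (Dw a)‖ ≤ (c * K₂ * ‖a - b‖) * (c * K₂') :=
      (ContinuousLinearMap.opNorm_comp_le _ _).trans (by
        rw [innerSL_apply_norm]
        exact mul_le_mul (hwL a b) (hDwB a) (norm_nonneg _) (by positivity))
    have h2 : ‖(innerSL ℝ (w b)).comp (Dw a - Dw b)‖ ≤ B * (c * K₃' * ‖a - b‖) :=
      (ContinuousLinearMap.opNorm_comp_le _ _).trans (by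
        rw [innerSL_apply_norm]
        exact mul_le_mul (hwB b) (hDwL a b) (norm_nonneg _) hB)
    have h3 := norm_add_le ((innerSL ℝ (w a - w b)).comp (Dw a)) ((innerSL ℝ (w b)).comp (Dw a - Dw b))
    have h4 : 0 ≤ ‖a - b‖ := norm_nonneg _
    nlinarith
  -- Fermat with a rate for `f ≤ W²`, and the deficit `W² − f(z) ≤ 2Wδ`
  have hfM : ∀ y, f y ≤ W ^ 2 := fun y => by
    rw [hf]
    exact pow_le_pow_left₀ (norm_nonneg _) (hWdom y) 2
  have hF := norm_fderiv_le_two_sqrt_of_le hfd hL0 hfL hfM z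
  have hW0 : 0 ≤ W := (norm_nonneg _).trans (hWdom z)
  have hdef : W ^ 2 - f z ≤ 2 * W * δ := by
    rw [hf]
    dsimp only
    have e1 : W ^ 2 - ‖w z‖ ^ 2 = (W - ‖w z‖) * (W + ‖w z‖) := by ring
    have e2 : (W - ‖w z‖) * (W + ‖w z‖) ≤ δ * (W + ‖w z‖) :=
      mul_le_mul_of_nonneg_right (by linarith) (by positivity)
    have e3 : δ * (W + ‖w z‖) ≤ δ * (2 * W) := mul_le_mul_of_nonneg_left (by linarith [hWdom z]) hδ
    linarith
  have hF' : ‖f' z‖ ≤ 2 * √(2 * W * δ * L) := by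
    rw [← hff']
    exact hF.trans (mul_le_mul_of_nonneg_left
      (Real.sqrt_le_sqrt (mul_le_mul_of_nonneg_right hdef hL0)) zero_le_two)
  -- back to `u`: the scale identities
  have hn : (0 - t) * ‖curl (u t) x‖ = ‖w z‖ := by
    conv_lhs => rw [← hxz, ← ht1]
    rw [← vorticityNumber_nsRescale, hw]
    norm_num
  have hg : (0 - t) * √(0 - t) * ‖fderiv ℝ (fun y => ‖curl (u t) y‖) x‖ =
      ‖fderiv ℝ (fun y => ‖w y‖) z‖ := by
    conv_lhs => rw [← hxz, ← ht1]
    rw [← gradNormNumber_nsRescale hlam0 u (-1) z, hw]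
    norm_num
  rw [hn, hg, show 2 * L * W * δ = 2 * W * δ * L by ring]
  by_cases hne : w z = 0
  · rw [hne, norm_zero, zero_mul]
    exact Real.sqrt_nonneg _
  · have hgrad : fderiv ℝ (fun y => ‖w y‖) z = (innerSL ℝ (vorticityDirection w z)).comp (Dw z) :=
      (hasFDerivAt_norm (hwd z) hne).fderiv
    have hξ : innerSL ℝ (w z) = ‖w z‖ • innerSL ℝ (vorticityDirection w z) := by
      have e : w z = ‖w z‖ • vorticityDirection w z := by
        rw [vorticityDirection_apply, smul_inv_smul₀ (norm_ne_zero_iff.mpr hne)]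
      conv_lhs => rw [e]
      rw [map_smulₛₗ, starRingEnd_apply, star_trivial]
    have hfz : f' z = (2 * ‖w z‖) • (innerSL ℝ (vorticityDirection w z)).comp (Dw z) := by
      rw [hf']
      dsimp only
      rw [hξ, ContinuousLinearMap.smul_comp, smul_smul]
    have hnf : ‖f' z‖ = 2 * (‖w z‖ * ‖fderiv ℝ (fun y => ‖w y‖) z‖) := by
      rw [hfz, norm_smul, Real.norm_of_nonneg (by positivity), hgrad, mul_assoc]
    linarith

/-- ★★ **THE NEAR-RECORD GRADIENT LAW WITH THE RATE `√δ`.**  There is `A = A(C₀,w₀) ≥ 0` such that at every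
point where the scale-invariant vorticity of a classical Type-I solution comes within `δ ≤ w₀/2` of an
upper bound `W ≥ w₀` of the scale-invariant vorticity AT THAT INSTANT,
`(0 − t)^{3/2}‖∇|ω|(t,x)‖ ≤ A·√δ`  (`A = 2√(A₀/w₀)` with `A₀` of the deficit law). [new-as-typed] -/
theorem typeI_nearRecord_gradient_rate {C₀ w₀ : ℝ} (hC₀ : 0 ≤ C₀) (hw₀ : 0 < w₀) :
    ∃ A : ℝ, 0 ≤ A ∧
      ∀ (u : ℝ → (EuclideanSpace ℝ (Fin 3)) → (EuclideanSpace ℝ (Fin 3))) (p : ℝ → (EuclideanSpace ℝ (Fin 3)) → ℝ)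
        (W t δ : ℝ) (x : EuclideanSpace ℝ (Fin 3)),
        IsClassicalNSSolutionOn (Iio 0) 1 0 u p → HasTypeIDecay C₀ u → t < 0 →
        (∀ y, (0 - t) * ‖curl (u t) y‖ ≤ W) → w₀ ≤ W → 0 ≤ δ → δ ≤ w₀ / 2 →
        W - δ ≤ (0 - t) * ‖curl (u t) x‖ →
        (0 - t) * √(0 - t) * ‖fderiv ℝ (fun y => ‖curl (u t) y‖) x‖ ≤ A * √δ := by
  obtain ⟨A₀, hA₀, hlaw⟩ := typeI_vorticityModulus_gradient_deficit hC₀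
  refine ⟨2 * √(A₀ / w₀), by positivity, fun u p W t δ x hsol hI ht hdom hW hδ hδ1 hnear => ?_⟩
  have h := hlaw u p W t δ x hsol hI ht hdom hδ hnear
  have hWpos : 0 < W := lt_of_lt_of_le hw₀ hW
  have hnpos : 0 < (0 - t) * ‖curl (u t) x‖ := by linarith
  have hn2 : W / 2 ≤ (0 - t) * ‖curl (u t) x‖ := by linarith
  have hG0 : 0 ≤ (0 - t) * √(0 - t) * ‖fderiv ℝ (fun y => ‖curl (u t) y‖) x‖ := by
    have : 0 < 0 - t := by linarith
    positivity
  have e : √(W ^ 2 * (A₀ / w₀) * δ) = W * (√(A₀ / w₀) * √δ) := by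
    rw [Real.sqrt_mul' _ hδ, Real.sqrt_mul' _ (by positivity : (0:ℝ) ≤ A₀ / w₀), Real.sqrt_sq hWpos.le,
      mul_assoc]
  have h3 : √(A₀ * W * δ) ≤ W * (√(A₀ / w₀) * √δ) := by
    rw [← e]
    refine Real.sqrt_le_sqrt ?_
    rw [show W ^ 2 * (A₀ / w₀) * δ = (W ^ 2 * A₀ * δ) / w₀ by ring, le_div_iff₀ hw₀]
    nlinarith [mul_nonneg (mul_nonneg hA₀ hδ) (mul_nonneg hWpos.le (sub_nonneg.mpr hW))]
  calc (0 - t) * √(0 - t) * ‖fderiv ℝ (fun y => ‖curl (u t) y‖) x‖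
      ≤ √(A₀ * W * δ) / ((0 - t) * ‖curl (u t) x‖) := by
        rw [le_div_iff₀ hnpos, mul_comm]; exact h
    _ ≤ √(A₀ * W * δ) / (W / 2) :=
        div_le_div_of_nonneg_left (Real.sqrt_nonneg _) (by positivity) hn2
    _ ≤ (W * (√(A₀ / w₀) * √δ)) / (W / 2) := div_le_div_of_nonneg_right h3 (by positivity)
    _ = 2 * √(A₀ / w₀) * √δ := by field_simp; try ring

/-- ★★ **NEAR-RECORD ε-CRITICALITY OF THE VORTICITY MODULUS ON `u` ITSELF** (qualitative form, explicit `δ`).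
For all `C₀`, `w₀ > 0`, `ε > 0` there is `δ > 0` (namely `min (w₀/2) (ε/(A+1))²`) such that at every space-time
point of every classical Type-I solution (constant `C₀`) where the scale-invariant vorticity comes within `δ` of
an upper bound `W ≥ w₀` of the vorticity number, `(0 − t)^{3/2}·‖∇|ω|(t,x)‖ ≤ ε`: near-record points need
not be spatial maxima of `|ω(t,·)|`, but they are ε-critical points of it at the parabolic scale. [new-as-typed] -/
theorem typeI_nearRecord_gradient_pinch (C₀ w₀ ε : ℝ) (hw₀ : 0 < w₀) (hε : 0 < ε) :
    ∃ δ : ℝ, 0 < δ ∧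
      ∀ (u : ℝ → (EuclideanSpace ℝ (Fin 3)) → (EuclideanSpace ℝ (Fin 3))) (p : ℝ → (EuclideanSpace ℝ (Fin 3)) → ℝ)
        (W t : ℝ) (x : EuclideanSpace ℝ (Fin 3)),
        IsClassicalNSSolutionOn (Iio 0) 1 0 u p → HasTypeIDecay C₀ u →
        (∀ s : ℝ, s < 0 → ∀ y, (0 - s) * ‖curl (u s) y‖ ≤ W) → w₀ ≤ W → t < 0 →
        W - δ ≤ (0 - t) * ‖curl (u t) x‖ →
        (0 - t) * √(0 - t) * ‖fderiv ℝ (fun y => ‖curl (u t) y‖) x‖ ≤ ε := by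
  by_cases hC₀ : 0 ≤ C₀
  · obtain ⟨A, hA, hrate⟩ := typeI_nearRecord_gradient_rate hC₀ hw₀
    refine ⟨min (w₀ / 2) ((ε / (A + 1)) ^ 2), lt_min (by positivity) (by positivity),
      fun u p W t x hsol hI hdom hW ht hnear => ?_⟩
    have h := hrate u p W t (min (w₀ / 2) ((ε / (A + 1)) ^ 2)) x hsol hI ht (hdom t ht) hW
      (le_min (by positivity) (by positivity)) (min_le_left _ _) hnear
    have hs : √(min (w₀ / 2) ((ε / (A + 1)) ^ 2)) ≤ ε / (A + 1) := by
      rw [← Real.sqrt_sq (by positivity : (0:ℝ) ≤ ε / (A + 1))]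
      exact Real.sqrt_le_sqrt (by rw [Real.sqrt_sq (by positivity)]; exact min_le_right _ _)
    have h2 : A * (ε / (A + 1)) ≤ ε := by
      rw [mul_div_assoc', div_le_iff₀ (by positivity)]
      nlinarith
    nlinarith [mul_le_mul_of_nonneg_left hs hA]
  · -- no Type-I solution has a negative constant unless trivial; the class with `C₀ < 0` is empty
    refine ⟨1, one_pos, fun u p W t x hsol hI hdom hW ht hnear => ?_⟩
    exact absurd (HasTypeIDecay.nonneg' hI) hC₀

end Summit.NavierStokesRegularity.NavierStokesRegularity.Theorems.StrainDoors

end
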